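import Mathlib
import Summits.NavierStokesRegularity.NavierStokesRegularity.Theorems.WakeRatchetTailRatchetRelaySolvability
import HarnessLib

/-!
# `WakeRatchet.TailRatchet` (stmt-NavierStokesRegularity-21808): the FROZEN-DILATION estimate — the
# linearisation at time ratio `s` differs from the one at `s = 2` by `O(|s−2|)` from `X_{1/2}` to `Y_{1/2}`

Support file for the crux `TailRatchet` (route `WakeRatchet`; MODEL lattice ODEs of Tao 2016 §1.2, §4 —
nothing in this file is a statement about the Navier–Stokes equations, and no item is closed here).

Context (census of stmt-21808, programme "R-lac", step R-lac-3): the nonlinear step of the lacunary-`Λ`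
construction is to be run at FIXED time ratio `s` near `2` with the drain `δ` as bordering unknown, using
the inverse of the `s = 2` bordered operator (`…RelayBorderedGeneral`) as approximate inverse.  This needs
the linearisation of `b ↦ (4/s²)b(t/s)²` at `b₀(t) = e^{t}`... more precisely at `e^{t}` evaluated with
dilation `s`, namely `η ↦ (8/s²)e^{t/s}η(t/s)`, to be close to the frozen one `η ↦ 2e^{t/2}η(t/2)` IN THE
WEIGHTED NORMS: the dilation mismatch `η(t/2) − η(t/s)` costs a derivative and a factor `|t|`, which the
coefficient `e^{t/s}` absorbs.  This file proves the estimate with explicit constants, sorry-free: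

* `abs_mul_exp_mul_le` — `|t|e^{ct} ≤ 1/(2c)` for `t ≤ 0`, `c > 0`;
* `exp_sub_exp_abs_le`, `sub_abs_le_of_deriv` — mean-value bounds on `(−∞, M]`;
* `frozen_dilation_estimate` — **for `3/2 ≤ s ≤ 5/2`, `t < 0`, and `η` with `|η(ξ)| ≤ He^{ξ/2}`,
  `|η'(ξ)| ≤ De^{ξ/2}` on `ξ < 0`:
  `|2e^{t/2}η(t/2) − (8/s²)e^{t/s}η(t/s)| ≤ |s−2|·(9H + 7D)·e^{t/2}`** —
  i.e. `‖(L_s − L_2)η‖_{Y_{1/2}} ≤ 16|s−2|·‖η‖_{X_{1/2}}`.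

HONEST FRAMING: elementary real analysis; MODEL lattice only; the construction item and the crux stay open;
lacunary fronts do NOT refute `TailRatchet` (which needs `Λ → 1`).
-/

noncomputable section

set_option linter.dupNamespace false

namespace Summit.NavierStokesRegularity.NavierStokesRegularity.Theorems

namespace WakeRatchetRelayFrozenDilation

open Set Filter Topology Real
open WakeRatchetRelaySolvability

/-! ## Elementary bounds -/

/-- `|t| e^{ct} ≤ 1/(2c)` for `t ≤ 0`, `c > 0` (from `x e^{−x} ≤ e^{−1} ≤ ½`). [folklore] -/
theorem abs_mul_exp_mul_le {c t : ℝ} (hc : 0 < c) (ht : t ≤ 0) : |t| * Real.exp (c * t) ≤ 1 / (2 * c) := by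
  have h1 := Real.mul_exp_neg_le_exp_neg_one (c * |t|)
  have h2 : Real.exp (-1) ≤ 1 / 2 := by
    have := Real.exp_one_gt_d9
    rw [Real.exp_neg, inv_le_comm₀ (Real.exp_pos 1) (by norm_num)]
    linarith
  have habs : |t| = -t := abs_of_nonpos ht
  have hexp : Real.exp (c * t) = Real.exp (-(c * |t|)) := by rw [habs]; ring_nf
  rw [hexp]
  have h3 : c * (|t| * Real.exp (-(c * |t|))) ≤ 1 / 2 := by
    calc c * (|t| * Real.exp (-(c * |t|))) = c * |t| * Real.exp (-(c * |t|)) := by ring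
      _ ≤ Real.exp (-1) := h1
      _ ≤ 1 / 2 := h2
  rw [le_div_iff₀ (by positivity)]
  linarith

/-- Mean value bound for `exp` below a level `M`: `|e^{a} − e^{b}| ≤ e^{M}|a − b|` for `a, b ≤ M`. [folklore] -/
theorem exp_sub_exp_abs_le {a b M : ℝ} (ha : a ≤ M) (hb : b ≤ M) :
    |Real.exp a - Real.exp b| ≤ Real.exp M * |a - b| := by
  have hconv : Convex ℝ (uIcc b a) := convex_uIcc _ _
  have hmem : ∀ x ∈ uIcc b a, x ≤ M := fun x hx => (mem_uIcc.1 hx).elim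
    (fun h => h.2.trans ha) (fun h => h.2.trans hb)
  have key := hconv.norm_image_sub_le_of_norm_hasDerivWithin_le
    (f := Real.exp) (f' := Real.exp)
    (fun x _ => (Real.hasDerivAt_exp x).hasDerivWithinAt)
    (fun x hx => by rw [Real.norm_eq_abs, abs_of_pos (Real.exp_pos _)]; exact Real.exp_le_exp.2 (hmem x hx))
    (left_mem_uIcc) (right_mem_uIcc)
  rw [Real.norm_eq_abs, Real.norm_eq_abs] at key
  exact key

/-- Mean value bound for `η` on `(−∞,0)` with `|η'| ≤ De^{ξ/2}`: for `a, b ≤ M < 0`,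
`|η(a) − η(b)| ≤ D e^{M/2}|a − b|`. [folklore] -/
theorem sub_abs_le_of_deriv {η η' : ℝ → ℝ} {D a b M : ℝ}
    (hd : ∀ ξ : ℝ, ξ < 0 → HasDerivAt η (η' ξ) ξ) (hD : ∀ ξ : ℝ, ξ < 0 → |η' ξ| ≤ D * Real.exp (ξ / 2))
    (hM : M < 0) (ha : a ≤ M) (hb : b ≤ M) :
    |η a - η b| ≤ D * Real.exp (M / 2) * |a - b| := by
  have hD0 : 0 ≤ D := by
    have := hD M hM
    nlinarith [abs_nonneg (η' M), Real.exp_pos (M / 2)]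
  have hconv : Convex ℝ (uIcc b a) := convex_uIcc _ _
  have hmem : ∀ x ∈ uIcc b a, x ≤ M := fun x hx => (mem_uIcc.1 hx).elim
    (fun h => h.2.trans ha) (fun h => h.2.trans hb)
  have key := hconv.norm_image_sub_le_of_norm_hasDerivWithin_le (f := η) (f' := η')
    (fun x hx => (hd x (lt_of_le_of_lt (hmem x hx) hM)).hasDerivWithinAt)
    (fun x hx => by
      have hxM := hmem x hx
      rw [Real.norm_eq_abs]
      calc |η' x| ≤ D * Real.exp (x / 2) := hD x (lt_of_le_of_lt hxM hM)
        _ ≤ D * Real.exp (M / 2) := mul_le_mul_of_nonneg_left (Real.exp_le_exp.2 (by linarith)) hD0)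
    (left_mem_uIcc) (right_mem_uIcc)
  rw [Real.norm_eq_abs, Real.norm_eq_abs] at key
  exact key

/-! ## The frozen-dilation estimate -/

/-- **FROZEN-DILATION ESTIMATE.**  Let `3/2 ≤ s ≤ 5/2`, and let `η` be differentiable on `t < 0` with
`|η(ξ)| ≤ He^{ξ/2}` (`ξ ≤ 0`) and `|η'(ξ)| ≤ De^{ξ/2}` (`ξ < 0`).  Then for every `t < 0`
`|2e^{t/2}η(t/2) − (8/s²)e^{t/s}η(t/s)| ≤ |s − 2|·(9H + 7D)·e^{t/2}`.
[cite: Tao2016AveragedNS, §1.2 (dyadic model); cell vocabulary (linearisations of the scalar front equation of `DyadicScalarFronts` at time ratios `s` and `2`; programme R-lac, step R-lac-3)] -/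
theorem frozen_dilation_estimate {s : ℝ} (hs1 : 3 / 2 ≤ s) (hs2 : s ≤ 5 / 2) {η η' : ℝ → ℝ} {H D : ℝ}
    (hd : ∀ ξ : ℝ, ξ < 0 → HasDerivAt η (η' ξ) ξ)
    (hH : ∀ ξ : ℝ, ξ ≤ 0 → |η ξ| ≤ H * Real.exp (ξ / 2))
    (hD : ∀ ξ : ℝ, ξ < 0 → |η' ξ| ≤ D * Real.exp (ξ / 2)) {t : ℝ} (ht : t < 0) :
    |2 * Real.exp (t / 2) * η (t / 2) - 8 / s ^ 2 * Real.exp (t / s) * η (t / s)| ≤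
      |s - 2| * (9 * H + 7 * D) * Real.exp (t / 2) := by
  have hs0 : 0 < s := by linarith
  have hH0 : 0 ≤ H := by
    have := hH 0 le_rfl
    rw [zero_div, Real.exp_zero, mul_one] at this
    exact (abs_nonneg _).trans this
  have hD0 : 0 ≤ D := by
    have := hD (-1) (by norm_num)
    nlinarith [abs_nonneg (η' (-1)), Real.exp_pos ((-1 : ℝ) / 2)]
  -- basic facts about `s`
  have hinv1 : 1 / s ≤ 2 / 3 := by rw [div_le_div_iff₀ hs0 (by norm_num)]; linarith
  have hinv2 : 2 / 5 ≤ 1 / s := by rw [div_le_div_iff₀ (by norm_num) hs0]; linarith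
  have h8s : 8 / s ^ 2 ≤ 4 := by
    rw [div_le_iff₀ (by positivity)]; nlinarith
  have h8s0 : 0 ≤ 8 / s ^ 2 := by positivity
  have hcoef : |2 - 8 / s ^ 2| ≤ 4 * |s - 2| := by
    have hs2ne : s ^ 2 ≠ 0 := by positivity
    have : 2 - 8 / s ^ 2 = (s - 2) * (2 * (s + 2) / s ^ 2) := by field_simp; ring
    rw [this, abs_mul]
    have hfac : |2 * (s + 2) / s ^ 2| ≤ 4 := by
      rw [abs_of_pos (by positivity), div_le_iff₀ (by positivity)]
      nlinarith
    calc |s - 2| * |2 * (s + 2) / s ^ 2| ≤ |s - 2| * 4 := mul_le_mul_of_nonneg_left hfac (abs_nonneg _)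
      _ = 4 * |s - 2| := by ring
  have hdil : |t / 2 - t / s| ≤ |t| * |s - 2| / 3 := by
    have : t / 2 - t / s = t * ((s - 2) / (2 * s)) := by field_simp
    rw [this, abs_mul, abs_div, abs_of_pos (by positivity : (0 : ℝ) < 2 * s)]
    rw [mul_div_assoc]
    refine mul_le_mul_of_nonneg_left ?_ (abs_nonneg _)
    rw [div_le_div_iff₀ (by positivity) (by norm_num)]
    nlinarith [abs_nonneg (s - 2)]
  -- positions: `t/2, t/s ≤ 2t/5 < 0`
  set M : ℝ := 2 / 5 * t with hM
  have hM0 : M < 0 := by rw [hM]; linarith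
  have ha : t / 2 ≤ M := by rw [hM]; linarith
  have hb : t / s ≤ M := by
    rw [hM, div_eq_mul_one_div, mul_comm]
    nlinarith
  have hts0 : t / s < 0 := div_neg_of_neg_of_pos ht hs0
  -- Term B: the dilation mismatch of `η`
  have hB1 : |η (t / 2) - η (t / s)| ≤ D * Real.exp (M / 2) * |t / 2 - t / s| :=
    sub_abs_le_of_deriv hd hD hM0 ha hb
  -- Term A: the coefficient mismatch
  have hA1 : |Real.exp (t / 2) - Real.exp (t / s)| ≤ Real.exp M * |t / 2 - t / s| :=
    exp_sub_exp_abs_le ha hb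
  have heM : Real.exp (t / 2) ≤ Real.exp M := Real.exp_le_exp.2 ha
  have hesM : Real.exp (t / s) ≤ Real.exp M := Real.exp_le_exp.2 hb
  -- split
  have hsplit : 2 * Real.exp (t / 2) * η (t / 2) - 8 / s ^ 2 * Real.exp (t / s) * η (t / s) =
      (2 * Real.exp (t / 2) - 8 / s ^ 2 * Real.exp (t / s)) * η (t / 2) +
        8 / s ^ 2 * Real.exp (t / s) * (η (t / 2) - η (t / s)) := by ring
  rw [hsplit]
  have hηa : |η (t / 2)| ≤ H * Real.exp (t / 2 / 2) := hH _ (by linarith)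
  -- bound the coefficient difference
  have hcd : |2 * Real.exp (t / 2) - 8 / s ^ 2 * Real.exp (t / s)| ≤
      |s - 2| * Real.exp M * (4 + 4 / 3 * |t|) := by
    have : 2 * Real.exp (t / 2) - 8 / s ^ 2 * Real.exp (t / s) =
        (2 - 8 / s ^ 2) * Real.exp (t / 2) + 8 / s ^ 2 * (Real.exp (t / 2) - Real.exp (t / s)) := by ring
    rw [this]
    calc |(2 - 8 / s ^ 2) * Real.exp (t / 2) + 8 / s ^ 2 * (Real.exp (t / 2) - Real.exp (t / s))|
        ≤ |(2 - 8 / s ^ 2) * Real.exp (t / 2)| + |8 / s ^ 2 * (Real.exp (t / 2) - Real.exp (t / s))| :=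
          abs_add_le _ _
      _ = |2 - 8 / s ^ 2| * Real.exp (t / 2) + 8 / s ^ 2 * |Real.exp (t / 2) - Real.exp (t / s)| := by
          rw [abs_mul, abs_mul, abs_of_pos (Real.exp_pos _), abs_of_nonneg h8s0]
      _ ≤ 4 * |s - 2| * Real.exp M + 4 * (Real.exp M * (|t| * |s - 2| / 3)) := by
          refine add_le_add (mul_le_mul hcoef heM (Real.exp_pos _).le (by positivity)) ?_
          exact mul_le_mul h8s (hA1.trans (mul_le_mul_of_nonneg_left hdil (Real.exp_pos _).le))
            (abs_nonneg _) (by norm_num)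
      _ = |s - 2| * Real.exp M * (4 + 4 / 3 * |t|) := by ring
  -- Term A bound
  have hTA : |(2 * Real.exp (t / 2) - 8 / s ^ 2 * Real.exp (t / s)) * η (t / 2)| ≤
      |s - 2| * H * (Real.exp M * Real.exp (t / 4) * (4 + 4 / 3 * |t|)) := by
    rw [abs_mul]
    have e1 : Real.exp (t / 2 / 2) = Real.exp (t / 4) := by ring_nf
    rw [e1] at hηa
    calc |2 * Real.exp (t / 2) - 8 / s ^ 2 * Real.exp (t / s)| * |η (t / 2)|
        ≤ (|s - 2| * Real.exp M * (4 + 4 / 3 * |t|)) * (H * Real.exp (t / 4)) :=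
          mul_le_mul hcd hηa (abs_nonneg _) (by positivity)
      _ = |s - 2| * H * (Real.exp M * Real.exp (t / 4) * (4 + 4 / 3 * |t|)) := by ring
  -- Term B bound
  have hTB : |8 / s ^ 2 * Real.exp (t / s) * (η (t / 2) - η (t / s))| ≤
      |s - 2| * D * (4 / 3 * (Real.exp M * Real.exp (M / 2) * |t|)) := by
    rw [abs_mul, abs_mul, abs_of_nonneg h8s0, abs_of_pos (Real.exp_pos _)]
    calc 8 / s ^ 2 * Real.exp (t / s) * |η (t / 2) - η (t / s)|
        ≤ 4 * Real.exp M * (D * Real.exp (M / 2) * (|t| * |s - 2| / 3)) :=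
          mul_le_mul (mul_le_mul h8s hesM (Real.exp_pos _).le (by norm_num))
            (hB1.trans (mul_le_mul_of_nonneg_left hdil (by positivity))) (abs_nonneg _) (by positivity)
      _ = |s - 2| * D * (4 / 3 * (Real.exp M * Real.exp (M / 2) * |t|)) := by ring
  -- compare the `t`-dependent factors with `e^{t/2}`
  have hexpA : Real.exp M * Real.exp (t / 4) = Real.exp (3 / 20 * t) * Real.exp (t / 2) := by
    rw [← Real.exp_add, ← Real.exp_add, hM]; ring_nf
  have hexpB : Real.exp M * Real.exp (M / 2) = Real.exp (1 / 10 * t) * Real.exp (t / 2) := by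
    rw [← Real.exp_add, ← Real.exp_add, hM]; ring_nf
  have htA := abs_mul_exp_mul_le (by norm_num : (0 : ℝ) < 3 / 20) ht.le
  have htB := abs_mul_exp_mul_le (by norm_num : (0 : ℝ) < 1 / 10) ht.le
  have heA1 : Real.exp (3 / 20 * t) ≤ 1 := Real.exp_le_one_iff.2 (by linarith)
  have hfacA : Real.exp M * Real.exp (t / 4) * (4 + 4 / 3 * |t|) ≤ 9 * Real.exp (t / 2) := by
    rw [hexpA]
    have e0 := Real.exp_pos (t / 2)
    have : Real.exp (3 / 20 * t) * (4 + 4 / 3 * |t|) ≤ 9 := by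
      have h1 : Real.exp (3 / 20 * t) * (4 + 4 / 3 * |t|) =
          4 * Real.exp (3 / 20 * t) + 4 / 3 * (|t| * Real.exp (3 / 20 * t)) := by ring
      rw [h1]
      norm_num at htA
      nlinarith
    calc Real.exp (3 / 20 * t) * Real.exp (t / 2) * (4 + 4 / 3 * |t|)
        = (Real.exp (3 / 20 * t) * (4 + 4 / 3 * |t|)) * Real.exp (t / 2) := by ring
      _ ≤ 9 * Real.exp (t / 2) := mul_le_mul_of_nonneg_right this e0.le
  have hfacB : 4 / 3 * (Real.exp M * Real.exp (M / 2) * |t|) ≤ 7 * Real.exp (t / 2) := by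
    rw [hexpB]
    have e0 := Real.exp_pos (t / 2)
    have : 4 / 3 * (|t| * Real.exp (1 / 10 * t)) ≤ 7 := by
      norm_num at htB
      nlinarith
    calc 4 / 3 * (Real.exp (1 / 10 * t) * Real.exp (t / 2) * |t|)
        = (4 / 3 * (|t| * Real.exp (1 / 10 * t))) * Real.exp (t / 2) := by ring
      _ ≤ 7 * Real.exp (t / 2) := mul_le_mul_of_nonneg_right this e0.le
  calc |(2 * Real.exp (t / 2) - 8 / s ^ 2 * Real.exp (t / s)) * η (t / 2) +
        8 / s ^ 2 * Real.exp (t / s) * (η (t / 2) - η (t / s))|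
      ≤ |(2 * Real.exp (t / 2) - 8 / s ^ 2 * Real.exp (t / s)) * η (t / 2)| +
        |8 / s ^ 2 * Real.exp (t / s) * (η (t / 2) - η (t / s))| := abs_add_le _ _
    _ ≤ |s - 2| * H * (9 * Real.exp (t / 2)) + |s - 2| * D * (7 * Real.exp (t / 2)) :=
        add_le_add (hTA.trans (mul_le_mul_of_nonneg_left hfacA (by positivity)))
          (hTB.trans (mul_le_mul_of_nonneg_left hfacB (by positivity)))
    _ = |s - 2| * (9 * H + 7 * D) * Real.exp (t / 2) := by ring

end WakeRatchetRelayFrozenDilation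

end Summit.NavierStokesRegularity.NavierStokesRegularity.Theorems

end
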